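import Summits.FinalStateConjecture.FinalStateConjecture.Theorems.ExactKerrEndsTameEscapeToKerrEndsUnitCurvePrep
import Summits.FinalStateConjecture.FinalStateConjecture.Theorems.ExactKerrEndsTameEscapeToKerrEndsGluingCurve
import HarnessLib

/-!
# Route `ExactKerrEnds`, crux `TameEscapeToKerrEnds` (stmt-FinalStateConjecture-18522), line
# `matched-kerr-solution-map`: the analytic stub at UNIT scale (part 2)

The curve-indexed matched Kerr gluing S1♭ (`ExactKerrEndsTameEscapeToKerrEndsGluingCurve.lean`) asks for a curve of
admissible Kerr-ended data ON `X` converging to `d` in the weighted distance of the end.  This file strips the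
manifold bookkeeping: it suffices to produce, along a smooth curve of gluing radii `R s → ∞`, data `O s` on `ℝ³`
at UNIT scale — vacuum on `{1 < ‖y‖}`, equal to the rescaled chart data of `d` on `{1 < ‖y‖ < 2}`, DR-flat at unit
scale with mass `μ s` (`R s μ s → M`), within `ε s` of the rescaled chart data of `d` in weighted `C² × C¹`
(`R s ε s → 0`), jointly smooth, and an exact spacelike Kerr leaf beyond `32 R s` after dilation by `R s`
(hypothesis S1♭♭, stated inline); the glued datum on `X` is the far patch `d ⋈ coord^*((O s).dilate (R s))` of the
sibling crux `SwallowTheDatum.ParametricKerrBurial` (part 1 = `…UnitCurvePrep.lean`).  Results: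
`wDist_le_of_unitDev` (weighted distance of a far patch `≤ 2Rε`), `matchedKerrGluingCurve_of_unitCurve` (S1♭♭ ⇒ S1♭),
`tameEscapeToKerrEnds_of_unitKerrGluingCurve_of_pmt_of_rigidity` (crux ⟸ S1♭♭ ∧ PMT ∧ rigidity).  UNPRINTED remains
exactly S1♭♭ (Corvino–Schoen 2006 Thm 4 / Chruściel–Delay 2003 Thm 8.1 / Mao–Oh–Tao 2023 Thm 1.3 + Lemma 5.5 give each
radius; smooth dependence along a curve of radii, the rest-frame DR form of the selected leaf and the `o(1/R)` weighted
`C² × C¹` control of the corrector are not in print).  References: Corvino 2000, §4; Bartnik 1986, §1;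
Bartnik–Isenberg 2004, §2; Dafermos–Rodnianski 2013, App. B.2.3; Christodoulou 1999, p. A24.
-/

set_option linter.dupNamespace false
-- instance search through the nested operator type `E3 →L[ℝ] E3 →L[ℝ] ℝ` (as in the sibling files)
set_option maxSynthPendingDepth 3

noncomputable section

namespace Summit.FinalStateConjecture.FinalStateConjecture.Theorems.ExactKerrEnds

open scoped Manifold ContDiff Topology ENNReal
open Set Filter Function Metric Bornology Asymptotics Literature.Geometry.Lorentzian Literature.Geometry.Manifold
open Summit.FinalStateConjecture.FinalStateConjecture.Theorems.SwallowTheDatum.ParametricKerrBurial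
  (SmoothSectionsOn AgreeAt VacuumOn farPatchData hCoeff_patch_eq vacuumOn_dilate
    patch_mem_admissibleVacuumData_of_vacuumOn)

variable {X : Type} [TopologicalSpace X] [ChartedSpace E3 X] [IsManifold (𝓡 3) ∞ X]

/-! ## §4 The weighted distance of a far patch from unit-scale deviation bounds -/
/-- **Weighted distance of a far-patched datum from its unit-scale deviation.** If the chart components of `G`
and `d` on `e` agree on `{e.R < ‖z‖ < 2R}`, those of `G` read `H(z/R)`, `R⁻¹ K(z/R)` beyond `5R/4` (`R > max(e.R, 1)`,
`K` smooth), and the unit-scale deviations `Δh = H − hCoeff e d (R ·)`, `Δk = K − R kCoeff e d (R ·)` obey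
`‖y‖^{1+m} ‖∂ᵐΔh(y)‖ ≤ ε` (`m ≤ 2`), `‖y‖^{2+m} ‖∂ᵐΔk(y)‖ ≤ ε` (`m ≤ 1`) on `{1 < ‖y‖}`, then `e.wDist G d ≤ Rε + Rε`
(inside `2R` the differences vanish near every point; beyond, they are dilates of `Δh`, `R⁻¹Δk`, and the weights
scale by one power of `R`, `norm_iteratedFDeriv_le_of_eqOn_dilation`). [cite: DafermosRodnianski2013, App. B.2.3] -/
theorem wDist_le_of_unitDev (e : AFEnd X) (d G : InitialDataSet (𝓡 3) X) {R ε : ℝ} (hR : max e.R 1 < R)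
    (H K : E3 → E3 →L[ℝ] E3 →L[ℝ] ℝ) (hKs : ContDiff ℝ ∞ K)
    (hfar_h : ∀ z : E3, 5 / 4 * R < ‖z‖ → AFEnd.hCoeff e G z = H (R⁻¹ • z))
    (hfar_k : ∀ z : E3, 5 / 4 * R < ‖z‖ → AFEnd.kCoeff e G z = R⁻¹ • K (R⁻¹ • z))
    (hnear_h : ∀ z : E3, e.R < ‖z‖ → ‖z‖ < 2 * R → AFEnd.hCoeff e G z = AFEnd.hCoeff e d z)
    (hnear_k : ∀ z : E3, e.R < ‖z‖ → ‖z‖ < 2 * R → AFEnd.kCoeff e G z = AFEnd.kCoeff e d z)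
    (hdev_h : ∀ m : ℕ, m ≤ 2 → ∀ y : E3, 1 < ‖y‖ →
      ‖y‖ ^ (1 + m) * ‖iteratedFDeriv ℝ m (fun y ↦ H y - AFEnd.hCoeff e d (R • y)) y‖ ≤ ε)
    (hdev_k : ∀ m : ℕ, m ≤ 1 → ∀ y : E3, 1 < ‖y‖ →
      ‖y‖ ^ (2 + m) * ‖iteratedFDeriv ℝ m (fun y ↦ K y - R • AFEnd.kCoeff e d (R • y)) y‖ ≤ ε) :
    e.wDist G d ≤ ENNReal.ofReal (R * ε) + ENNReal.ofReal (R * ε) := by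
  have hRe : e.R < R := lt_of_le_of_lt (le_max_left _ _) hR
  have hR1 : 1 < R := lt_of_le_of_lt (le_max_right _ _) hR
  have hR0 : 0 < R := by linarith
  have hnorm : ∀ z : E3, ‖R⁻¹ • z‖ = R⁻¹ * ‖z‖ := fun z ↦ by
    rw [norm_smul, norm_inv, Real.norm_of_nonneg hR0.le]
  have hone : ∀ m : ℕ, R⁻¹ ^ m * R ^ m = 1 := fun m ↦ by rw [← mul_pow, inv_mul_cancel₀ hR0.ne', one_pow]
  have hzero : ∀ (F : E3 → E3 →L[ℝ] E3 →L[ℝ] ℝ) (m : ℕ) {x : E3},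
      (∀ z : E3, e.R < ‖z‖ → ‖z‖ < 2 * R → F z = 0) → e.R < ‖x‖ → ‖x‖ < 2 * R →
      iteratedFDeriv ℝ m F x = 0 := by
    intro F m x hF hx1 hx2
    have hev : F =ᶠ[𝓝 x] fun _ ↦ 0 := by
      filter_upwards [(isOpen_lt continuous_const continuous_norm).mem_nhds hx1,
        (isOpen_lt continuous_norm continuous_const).mem_nhds hx2] with z hz1 hz2
      exact hF z hz1 hz2
    rw [(hev.iteratedFDeriv ℝ m).eq_of_nhds, iteratedFDeriv_fun_zero]
    rfl
  unfold AFEnd.wDist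
  refine add_le_add (iSup₂_le fun m hm ↦ iSup₂_le fun x hx ↦ ?_) (iSup₂_le fun m hm ↦ iSup₂_le fun x hx ↦ ?_)
  · -- the metric part
    by_cases hx2 : ‖x‖ < 2 * R
    · rw [hzero _ m (fun z hz1 hz2 ↦ by rw [hnear_h z hz1 hz2, sub_self]) hx hx2]
      simp
    · rw [not_lt] at hx2
      have hx54 : 5 / 4 * R < ‖x‖ := by linarith
      set y : E3 := R⁻¹ • x with hy
      have hyn : ‖y‖ = R⁻¹ * ‖x‖ := hnorm x
      have hy1 : 1 < ‖y‖ := by rw [hyn, lt_inv_mul_iff₀ hR0]; linarith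
      have hxy : ‖x‖ = R * ‖y‖ := by rw [hyn]; field_simp
      have hle := norm_iteratedFDeriv_le_of_eqOn_dilation (F := fun y ↦ H y - AFEnd.hCoeff e d (R • y))
        (G := fun z ↦ AFEnd.hCoeff e G z - AFEnd.hCoeff e d z) (inv_ne_zero hR0.ne')
        (fun z hz ↦ by rw [hfar_h z hz, smul_inv_smul₀ hR0.ne']) m hx54
      have hreal : ‖x‖ ^ (1 + m) * ‖iteratedFDeriv ℝ m (fun z ↦ AFEnd.hCoeff e G z - AFEnd.hCoeff e d z) x‖ ≤
          R * ε := by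
        calc ‖x‖ ^ (1 + m) * ‖iteratedFDeriv ℝ m (fun z ↦ AFEnd.hCoeff e G z - AFEnd.hCoeff e d z) x‖
            ≤ ‖x‖ ^ (1 + m) * (|R⁻¹| ^ m *
                ‖iteratedFDeriv ℝ m (fun y ↦ H y - AFEnd.hCoeff e d (R • y)) y‖) :=
              mul_le_mul_of_nonneg_left hle (by positivity)
          _ = R * (R⁻¹ ^ m * R ^ m) *
                (‖y‖ ^ (1 + m) * ‖iteratedFDeriv ℝ m (fun y ↦ H y - AFEnd.hCoeff e d (R • y)) y‖) := by
              rw [abs_of_pos (inv_pos.2 hR0), hxy, mul_pow]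
              ring
          _ = R * (‖y‖ ^ (1 + m) * ‖iteratedFDeriv ℝ m (fun y ↦ H y - AFEnd.hCoeff e d (R • y)) y‖) := by
              rw [hone m, mul_one]
          _ ≤ R * ε := mul_le_mul_of_nonneg_left (hdev_h m hm y hy1) hR0.le
      calc ENNReal.ofReal (‖x‖ ^ (1 + m)) *
            ‖iteratedFDeriv ℝ m (fun z ↦ AFEnd.hCoeff e G z - AFEnd.hCoeff e d z) x‖ₑ
          = ENNReal.ofReal (‖x‖ ^ (1 + m) *
              ‖iteratedFDeriv ℝ m (fun z ↦ AFEnd.hCoeff e G z - AFEnd.hCoeff e d z) x‖) := by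
            rw [← ofReal_norm, ENNReal.ofReal_mul (by positivity)]
        _ ≤ ENNReal.ofReal (R * ε) := ENNReal.ofReal_le_ofReal hreal
  · -- the `k` part
    by_cases hx2 : ‖x‖ < 2 * R
    · rw [hzero _ m (fun z hz1 hz2 ↦ by rw [hnear_k z hz1 hz2, sub_self]) hx hx2]
      simp
    · rw [not_lt] at hx2
      have hx54 : 5 / 4 * R < ‖x‖ := by linarith
      set y : E3 := R⁻¹ • x with hy
      have hyn : ‖y‖ = R⁻¹ * ‖x‖ := hnorm x
      have hy1 : 1 < ‖y‖ := by rw [hyn, lt_inv_mul_iff₀ hR0]; linarith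
      have hxy : ‖x‖ = R * ‖y‖ := by rw [hyn]; field_simp
      -- the unit-scale deviation `Δk` is smooth beyond radius `1`
      have hΔ : ∀ y : E3, 1 < ‖y‖ →
          ContDiffAt ℝ m (fun y ↦ K y - R • AFEnd.kCoeff e d (R • y)) y := by
        intro y hy
        have hRy : e.R < ‖R • y‖ := by
          rw [norm_smul, Real.norm_of_nonneg hR0.le]; nlinarith
        have hk : ContDiffAt ℝ ∞ (AFEnd.kCoeff e d) (R • y) :=
          (AFEnd.ContDiffOn_kCoeff_holds e d).contDiffAt
            ((isOpen_lt continuous_const continuous_norm).mem_nhds hRy)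
        have hcomp : ContDiffAt ℝ ∞ (fun y : E3 ↦ AFEnd.kCoeff e d (R • y)) y :=
          hk.comp y (contDiffAt_id.const_smul R)
        exact (hKs.contDiffAt.sub (hcomp.const_smul R)).of_le (by exact_mod_cast le_top)
      have hle := norm_iteratedFDeriv_le_of_eqOn_dilation
        (F := fun y ↦ R⁻¹ • (K y - R • AFEnd.kCoeff e d (R • y)))
        (G := fun z ↦ AFEnd.kCoeff e G z - AFEnd.kCoeff e d z) (inv_ne_zero hR0.ne')
        (fun z hz ↦ by
          rw [hfar_k z hz, smul_sub, smul_inv_smul₀ hR0.ne', smul_smul, inv_mul_cancel₀ hR0.ne',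
            one_smul]) m hx54
      have hsmul : iteratedFDeriv ℝ m (fun y ↦ R⁻¹ • (K y - R • AFEnd.kCoeff e d (R • y))) y =
          R⁻¹ • iteratedFDeriv ℝ m (fun y ↦ K y - R • AFEnd.kCoeff e d (R • y)) y :=
        iteratedFDeriv_const_smul_apply' (hΔ y hy1)
      have hreal : ‖x‖ ^ (2 + m) * ‖iteratedFDeriv ℝ m (fun z ↦ AFEnd.kCoeff e G z - AFEnd.kCoeff e d z) x‖ ≤
          R * ε := by
        calc ‖x‖ ^ (2 + m) * ‖iteratedFDeriv ℝ m (fun z ↦ AFEnd.kCoeff e G z - AFEnd.kCoeff e d z) x‖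
            ≤ ‖x‖ ^ (2 + m) * (|R⁻¹| ^ m *
                ‖iteratedFDeriv ℝ m (fun y ↦ R⁻¹ • (K y - R • AFEnd.kCoeff e d (R • y))) y‖) :=
              mul_le_mul_of_nonneg_left hle (by positivity)
          _ = R * (R⁻¹ ^ m * R ^ m) * (R⁻¹ * R) *
                (‖y‖ ^ (2 + m) * ‖iteratedFDeriv ℝ m (fun y ↦ K y - R • AFEnd.kCoeff e d (R • y)) y‖) := by
              rw [hsmul, norm_smul, norm_inv, Real.norm_of_nonneg hR0.le, abs_of_pos (inv_pos.2 hR0), hxy,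
                mul_pow]
              ring
          _ = R * (‖y‖ ^ (2 + m) * ‖iteratedFDeriv ℝ m (fun y ↦ K y - R • AFEnd.kCoeff e d (R • y)) y‖) := by
              rw [hone m, inv_mul_cancel₀ hR0.ne', mul_one, mul_one]
          _ ≤ R * ε := mul_le_mul_of_nonneg_left (hdev_k m hm y hy1) hR0.le
      calc ENNReal.ofReal (‖x‖ ^ (2 + m)) *
            ‖iteratedFDeriv ℝ m (fun z ↦ AFEnd.kCoeff e G z - AFEnd.kCoeff e d z) x‖ₑ
          = ENNReal.ofReal (‖x‖ ^ (2 + m) *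
              ‖iteratedFDeriv ℝ m (fun z ↦ AFEnd.kCoeff e G z - AFEnd.kCoeff e d z) x‖) := by
            rw [← ofReal_norm, ENNReal.ofReal_mul (by positivity)]
        _ ≤ ENNReal.ofReal (R * ε) := ENNReal.ofReal_le_ofReal hreal

/-! ## §5 The curve-indexed S1♭ from its unit-scale form S1♭♭ -/
/-- **The curve-indexed matched Kerr gluing S1♭ from its UNIT-SCALE form S1♭♭** (fixed `X, d, e, M`).  From the
unit-scale data `(R, μ, ε, O)` of S1♭♭ (see the module docstring) build `G s := d ⋈ coord^*((O s).dilate (R s))`,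
patched across the chart shell `{5 R s/4 < ‖z‖ < 7 R s/4}` where both read `d`; then `G s` is admissible
(`patch_mem_admissibleVacuumData_of_vacuumOn`: vacuum dilate, sole DR identity end of `ℝ³`), equals `d` off
`e.far (R s)`, is DR on the SAME end `e` with mass `R s · μ s` (`of_coeff_dilation`), Kerr-ended (`chartKerrEnd`),
jointly smooth (`smoothSectionsOn_of_farPatchCurve`), and `e.wDist (G s) d ≤ 2 R s ε s → 0` (`wDist_le_of_unitDev`).
Corvino 2000, §4; Bartnik 1986, §1; Dafermos–Rodnianski 2013, App. B.2.3. [cite: Corvino2000, §4] -/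
theorem matchedKerrGluingCurve_of_unitCurve
    [T2Space X] [SecondCountableTopology X] [ConnectedSpace X] [Kerr.Facts]
    {d : InitialDataSet (𝓡 3) X} (hd : d ∈ admissibleVacuumData X) {e : AFEnd X} {M : ℝ}
    (hsole : e.IsSoleEnd)
    (h : ∃ (sstar : ℝ) (R μ ε : ℝ → ℝ) (O : ℝ → InitialDataSet (𝓡 3) E3),
      ContDiff ℝ ∞ R ∧ (∀ s, sstar < s → max e.R 1 < R s) ∧ Tendsto R atTop atTop ∧
      ContinuousOn μ (Ioi sstar) ∧ Tendsto (fun s ↦ R s * μ s) atTop (𝓝 M) ∧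
      Tendsto (fun s ↦ R s * ε s) atTop (𝓝 0) ∧
      SmoothSectionsOn 𝓘(ℝ, ℝ) O {p : ℝ × E3 | sstar < p.1 ∧ 1 < ‖p.2‖} ∧
      ∀ s, sstar < s →
        VacuumOn {y | 1 < ‖y‖} (O s) ∧
        (∀ y : E3, 1 < ‖y‖ → ‖y‖ < 2 →
          (O s).coordH y = AFEnd.hCoeff e d (R s • y) ∧ (O s).coordK y = R s • AFEnd.kCoeff e d (R s • y)) ∧
        (∀ m : ℕ, m ≤ 2 →
          (fun y ↦ ‖iteratedFDeriv ℝ m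
              (fun y ↦ (O s).coordH y - (1 + 2 * μ s / ‖y‖) • (innerSL ℝ : E3 →L[ℝ] E3 →L[ℝ] ℝ)) y‖)
            =o[cobounded E3] fun y ↦ ‖y‖ ^ (-1 - m : ℝ)) ∧
        (∀ m : ℕ, m ≤ 1 →
          (fun y ↦ ‖iteratedFDeriv ℝ m (O s).coordK y‖) =o[cobounded E3] fun y ↦ ‖y‖ ^ (-2 - m : ℝ)) ∧
        (∀ m : ℕ, m ≤ 2 → ∀ y : E3, 1 < ‖y‖ →
          ‖y‖ ^ (1 + m) * ‖iteratedFDeriv ℝ m (fun y ↦ (O s).coordH y - AFEnd.hCoeff e d (R s • y)) y‖ ≤ ε s) ∧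
        (∀ m : ℕ, m ≤ 1 → ∀ y : E3, 1 < ‖y‖ →
          ‖y‖ ^ (2 + m) *
            ‖iteratedFDeriv ℝ m (fun y ↦ (O s).coordK y - R s • AFEnd.kCoeff e d (R s • y)) y‖ ≤ ε s) ∧
        ∃ (M' a r₀ : ℝ) (hM' : 0 ≤ M') (ψ : exteriorRegion (32 * R s) → Kerr.region a r₀)
          (ν : NormalField 𝓘(ℝ, E4) ψ),
          Injective ψ ∧
          (Kerr.smoothMetric M' a r₀).IsSpacelikeImmersion 𝓘(ℝ, E3) ψ ∧
          (Kerr.smoothMetric M' a r₀).IsFutureUnitNormal 𝓘(ℝ, E3)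
            ((Kerr.timeOrientation M' a r₀ hM').ofLE le_top) ψ ν ∧
          (∀ (y : exteriorRegion (32 * R s)) (v w : E3),
            ((O s).dilateFamily (R s)).coordH (y : E3) v w =
              Kerr.bilin M' a (ψ y : E4) (mfderiv 𝓘(ℝ, E3) 𝓘(ℝ, E4) ψ y v)
                (mfderiv 𝓘(ℝ, E3) 𝓘(ℝ, E4) ψ y w)) ∧
          (∀ [(Kerr.smoothMetric M' a r₀).HasLeviCivita] (y : exteriorRegion (32 * R s)) (v w : E3),
            ((O s).dilateFamily (R s)).coordK (y : E3) v w =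
              (Kerr.smoothMetric M' a r₀).secondFundamentalForm 𝓘(ℝ, E3) ψ ν y v w)) :
    ∃ (sstar : ℝ) (ρ m : ℝ → ℝ) (G : ℝ → InitialDataSet (𝓡 3) X),
      Tendsto ρ atTop atTop ∧ ContinuousOn m (Ioi sstar) ∧ Tendsto m atTop (𝓝 M) ∧
      SmoothSectionsOn 𝓘(ℝ, ℝ) G {p : ℝ × X | sstar < p.1} ∧
      (∀ s : ℝ, sstar < s →
        G s ∈ admissibleVacuumData X ∧ (∀ x ∉ e.far (ρ s), AgreeAt (G s) d x) ∧
          e.IsStronglyAsymptoticallyFlatDR (G s) (m s) ∧ (G s).HasExactKerrEnd) ∧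
      Tendsto (fun s ↦ e.wDist (G s) d) atTop (𝓝 0) := by
  classical
  obtain ⟨sstar, R, μ, ε, O, hRd, hRs, hRtop, hμ, hμM, hε, hOs, hO⟩ := h
  obtain ⟨f, hfsole, hfR, hf⟩ := exists_identityEnd_one
  have hRe : ∀ {s : ℝ}, sstar < s → e.R < R s := fun hs ↦ lt_of_le_of_lt (le_max_left _ _) (hRs _ hs)
  have hR1 : ∀ {s : ℝ}, sstar < s → 1 < R s := fun hs ↦ lt_of_le_of_lt (le_max_right _ _) (hRs _ hs)
  have hR0 : ∀ {s : ℝ}, sstar < s → 0 < R s := fun hs ↦ lt_trans e.R_pos (hRe hs)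
  have hnorm : ∀ {s : ℝ}, sstar < s → ∀ y : E3, ‖(R s)⁻¹ • y‖ = (R s)⁻¹ * ‖y‖ := fun hs y ↦ by
    rw [norm_smul, norm_inv, Real.norm_of_nonneg (hR0 hs).le]
  have hCH : ∀ {s : ℝ} (hs : sstar < s) (z : E3),
      ((O s).dilate (R s) (hR0 hs)).coordH z = (O s).coordH ((R s)⁻¹ • z) := fun hs z ↦
    (O _).coordH_dilate _ _ z
  have hCK : ∀ {s : ℝ} (hs : sstar < s) (z : E3),
      ((O s).dilate (R s) (hR0 hs)).coordK z = (R s)⁻¹ • (O s).coordK ((R s)⁻¹ • z) := fun hs z ↦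
    (O _).coordK_dilate _ _ z
  -- on the shell `{5R/4 < ‖z‖ < 2R}` (indeed on `{R < ‖z‖ < 2R}`) the dilate reads `d`
  have hshell : ∀ {s : ℝ} (hs : sstar < s) (z : E3), R s < ‖z‖ → ‖z‖ < 2 * R s →
      ((O s).dilate (R s) (hR0 hs)).coordH z = AFEnd.hCoeff e d z ∧
        ((O s).dilate (R s) (hR0 hs)).coordK z = AFEnd.kCoeff e d z := by
    intro s hs z hz1 hz2
    have h1' : 1 < ‖(R s)⁻¹ • z‖ := by rw [hnorm hs, lt_inv_mul_iff₀ (hR0 hs)]; linarith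
    have h2' : ‖(R s)⁻¹ • z‖ < 2 := by rw [hnorm hs, inv_mul_lt_iff₀ (hR0 hs)]; linarith
    obtain ⟨hH, hK⟩ := (hO s hs).2.1 _ h1' h2'
    rw [smul_inv_smul₀ (hR0 hs).ne'] at hH hK
    refine ⟨by rw [hCH hs, hH], ?_⟩
    rw [hCK hs, hK, smul_smul, inv_mul_cancel₀ (hR0 hs).ne', one_smul]
  have hP : ∀ {s : ℝ} (hs : sstar < s), e.PatchData d (5 / 4 * R s) (7 / 4 * R s)
      (AFEnd.outerField e ((O s).dilate (R s) (hR0 hs)).coordH)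
      (AFEnd.outerField e ((O s).dilate (R s) (hR0 hs)).coordK) := by
    intro s hs
    have hR0s := hR0 hs; have hRes := hRe hs
    exact farPatchData (by linarith) (by linarith) fun y hy1 hy2 ↦ hshell hs y (by linarith) (by linarith)
  let G : ℝ → InitialDataSet (𝓡 3) X := fun s ↦ if hs : sstar < s then e.patch d (hP hs) else d
  have hG : ∀ {s : ℝ} (hs : sstar < s), G s = e.patch d (hP hs) := fun hs ↦ dif_pos hs
  have hfar : ∀ {s : ℝ} (hs : sstar < s) (z : E3), 5 / 4 * R s < ‖z‖ →
      AFEnd.hCoeff e (G s) z = (O s).coordH ((R s)⁻¹ • z) ∧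
        AFEnd.kCoeff e (G s) z = (R s)⁻¹ • (O s).coordK ((R s)⁻¹ • z) := by
    intro s hs z hz
    rw [hG hs, ← hCH hs, ← hCK hs]
    exact hCoeff_patch_eq (hP hs) hz
  have hnear : ∀ {s : ℝ} (hs : sstar < s) (z : E3), e.R < ‖z‖ → ‖z‖ < 2 * R s →
      AFEnd.hCoeff e (G s) z = AFEnd.hCoeff e d z ∧ AFEnd.kCoeff e (G s) z = AFEnd.kCoeff e d z := by
    intro s hs z hz1 hz2
    by_cases hz : 5 / 4 * R s < ‖z‖
    · rw [hG hs, (hCoeff_patch_eq (hP hs) hz).1, (hCoeff_patch_eq (hP hs) hz).2]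
      exact hshell hs z (by linarith [hR0 hs]) hz2
    · have hx : e.dataChartExt z ∉ e.far (5 / 4 * R s) := fun hmem ↦
        hz ((e.dataChartExt_mem_far_iff hz1).1 hmem)
      obtain ⟨hh, hk⟩ := AFEnd.patch_eq_of_not_mem_far (hP hs) hx
      refine ⟨?_, ?_⟩
      · ext v w
        rw [e.hCoeff_apply_eq_dataChartExt _ hz1, e.hCoeff_apply_eq_dataChartExt _ hz1, hG hs, hh]
      · ext v w
        rw [e.kCoeff_apply_eq_dataChartExt _ hz1, e.kCoeff_apply_eq_dataChartExt _ hz1, hG hs, hk]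
  have hODR : ∀ {s : ℝ} (hs : sstar < s), f.IsStronglyAsymptoticallyFlatDR (O s) (μ s) := fun {s} hs ↦
    isStronglyAsymptoticallyFlatDR_of_coordDecay hf (O s) (μ s) (hO s hs).2.2.1 (hO s hs).2.2.2.1
  refine ⟨sstar, R, fun s ↦ R s * μ s, G, hRtop, (hRd.continuous.continuousOn).mul hμ, hμM, ?_,
    fun s hs ↦ ⟨?_, fun x hx ↦ ?_, ?_, ?_⟩, ?_⟩
  · -- joint smoothness on `{s⋆ < s}`
    obtain ⟨hH, hK⟩ := contMDiffOn_rescaledCurve hRd (fun s hs ↦ (hR1 hs).le) hOs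
    have hGfar : ∀ q : ℝ × X, sstar < q.1 → q.2 ∈ e.far (5 / 4 * R q.1) →
        (G q.1).h.inner q.2 = AFEnd.outerField e (fun z ↦ (O q.1).coordH ((R q.1)⁻¹ • z)) q.2 ∧
          (G q.1).k q.2 = AFEnd.outerField e (fun z ↦ (R q.1)⁻¹ • (O q.1).coordK ((R q.1)⁻¹ • z)) q.2 := by
      intro q hq hx
      rw [hG hq]
      exact ⟨(AFEnd.patch_h_inner_of_mem (hP hq) hx).trans (e.outerField_congr (hCH hq _)),
        (AFEnd.patch_k_of_mem (hP hq) hx).trans (e.outerField_congr (hCK hq _))⟩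
    have hGin : ∀ q : ℝ × X, sstar < q.1 → q.2 ∉ e.closedFar (7 / 4 * R q.1) →
        (G q.1).h.inner q.2 = d.h.inner q.2 ∧ (G q.1).k q.2 = d.k q.2 := by
      intro q hq hx
      rw [hG hq]
      exact ⟨AFEnd.patch_h_inner_of_not_mem_closedFar (hP hq) hx,
        AFEnd.patch_k_of_not_mem_closedFar (hP hq) hx⟩
    exact ⟨smoothSectionsOn_of_farPatchCurve hRd.continuous hRs (fun q ↦ (G q.1).h.inner q.2) d.h.inner
        (fun s z ↦ (O s).coordH ((R s)⁻¹ • z)) d.h.contMDiff hH (fun q hq hx ↦ (hGfar q hq hx).1)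
        (fun q hq hx ↦ (hGin q hq hx).1),
      smoothSectionsOn_of_farPatchCurve hRd.continuous hRs (fun q ↦ (G q.1).k q.2) d.k
        (fun s z ↦ (R s)⁻¹ • (O s).coordK ((R s)⁻¹ • z)) d.contMDiff_k hK
        (fun q hq hx ↦ (hGfar q hq hx).2) (fun q hq hx ↦ (hGin q hq hx).2)⟩
  · -- admissibility: the dilate is vacuum on `{5R/4 < ‖z‖}` with a sole DR end (the identity end)
    have hR0s := hR0 hs
    have hdvac : ∀ [d.metric.HasLeviCivita], d.IsVacuumConstraintSolution := fun {inst} ↦ (hd.1).1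
    have hCvac : VacuumOn {y | 5 / 4 * R s < ‖y‖} ((O s).dilate (R s) hR0s) := by
      refine vacuumOn_dilate (O s) (hO s hs).1 hR0s fun y hy ↦ ?_
      show 1 < ‖(R s)⁻¹ • y‖
      rw [hnorm hs, lt_inv_mul_iff₀ hR0s, mul_one]
      change 5 / 4 * R s < ‖y‖ at hy
      linarith
    have hfdecay : f.IsStronglyAsymptoticallyFlatDR ((O s).dilate (R s) hR0s) (R s * μ s) :=
      isStronglyAsymptoticallyFlatDR_dilate_of hf (hODR hs) (hR1 hs).le
    rw [hG hs]
    exact patch_mem_admissibleVacuumData_of_vacuumOn (hP hs) hsole hdvac hCvac hfsole hfdecay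
  · -- agreement with `d` off `e.far (R s) ⊇ e.far (5 R s / 4)`
    have hx' : x ∉ e.far (5 / 4 * R s) := fun h' ↦ hx (e.far_mono (by linarith [hR0 hs]) h')
    show (G s).h.inner x = d.h.inner x ∧ (G s).k x = d.k x
    rw [hG hs]
    exact AFEnd.patch_eq_of_not_mem_far (hP hs) hx'
  · -- DR on the SAME end `e`, with mass `R s · μ s`
    have hR0s := hR0 hs
    have hin : ∀ ζ : E3, 5 / 4 * R s < ‖ζ‖ → 1 < ‖(R s)⁻¹ • ζ‖ := fun ζ hζ ↦ by
      rw [hnorm hs, lt_inv_mul_iff₀ hR0s, mul_one]; linarith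
    refine AFEnd.IsStronglyAsymptoticallyFlatDR.of_coeff_dilation (R₀ := 5 / 4 * R s) hR0s
      (fun ζ hζ ↦ ?_) (fun ζ hζ ↦ ?_) (hODR hs)
    · rw [(hfar hs ζ hζ).1, (hf (O s) _ (hin ζ hζ)).1]
    · rw [(hfar hs ζ hζ).2, (hf (O s) _ (hin ζ hζ)).2]
  · -- Kerr-endedness: chart-level exact Kerr beyond `32 R s`
    have hR0s := hR0 hs
    obtain ⟨M', a, r₀, hM', ψ, ν, hinj, himm, hν, hmet, hsff⟩ := (hO s hs).2.2.2.2.2.2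
    have hread : ∀ y : exteriorRegion (32 * R s),
        AFEnd.hCoeff e (G s) (y : E3) = ((O s).dilateFamily (R s)).coordH (y : E3) ∧
          AFEnd.kCoeff e (G s) (y : E3) = ((O s).dilateFamily (R s)).coordK (y : E3) := by
      intro y
      have hy : 5 / 4 * R s < ‖(y : E3)‖ := by
        have h32 : 32 * R s < ‖(y : E3)‖ := y.2
        linarith
      rw [(O s).dilateFamily_of_pos hR0s, hG hs]
      exact hCoeff_patch_eq (hP hs) hy
    -- `HasExactKerrEnd` hides a `[Kerr.Facts]` binder: expose it before applying `chartKerrEnd`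
    intro hKF'
    exact chartKerrEnd X e (G s) (32 * R s) hsole (by linarith [hRe hs])
      ⟨M', a, r₀, hM', ψ, ν, hinj, himm, hν, fun y v w ↦ by rw [(hread y).1]; exact hmet y v w,
        fun y v w ↦ by rw [(hread y).2]; exact hsff y v w⟩
  · -- the weighted distance: `e.wDist (G s) d ≤ 2 R s ε s → 0`
    have hbound : ∀ᶠ s in atTop, e.wDist (G s) d ≤ ENNReal.ofReal (R s * ε s) + ENNReal.ofReal (R s * ε s) := by
      filter_upwards [eventually_gt_atTop sstar] with s hs
      exact wDist_le_of_unitDev e d (G s) (hRs s hs) (O s).coordH (O s).coordK (O s).contMDiff_coordK.contDiff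
        (fun z hz ↦ (hfar hs z hz).1) (fun z hz ↦ (hfar hs z hz).2) (fun z hz1 hz2 ↦ (hnear hs z hz1 hz2).1)
        (fun z hz1 hz2 ↦ (hnear hs z hz1 hz2).2) (hO s hs).2.2.2.2.1 (hO s hs).2.2.2.2.2.1
    have hlim : Tendsto (fun s ↦ ENNReal.ofReal (R s * ε s) + ENNReal.ofReal (R s * ε s)) atTop (𝓝 0) := by
      have h0 := ENNReal.tendsto_ofReal hε
      rw [ENNReal.ofReal_zero] at h0; simpa using h0.add h0
    exact tendsto_of_tendsto_of_tendsto_of_le_of_le' tendsto_const_nhds hlim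
      (Eventually.of_forall fun _ ↦ bot_le) hbound

/-! ## §6 The crux from the unit-scale analytic stub S1♭♭ and the two named positive-mass facts -/
/-- **`TameEscapeToKerrEnds` modulo the UNIT-SCALE analytic stub S1♭♭ and the positive mass theorem with rigidity**:
S1♭♭ (for every `X`, admissible `d`, sole DR end `e` of mass parameter `M > 0`) gives S1♭
(`matchedKerrGluingCurve_of_unitCurve`), whence the crux (`tameEscapeToKerrEnds_of_matchedKerrGluingCurve_of_pmt_of_rigidity`;
Eichmair–Huang–Lee–Schoen 2016 Thm 1, Beig–Chruściel 1996 Thm 4.1 as named facts). [cite: BeigChrusciel1996, Thm. 4.1] -/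
theorem tameEscapeToKerrEnds_of_unitKerrGluingCurve_of_pmt_of_rigidity :
    (∀ (X : Type) [TopologicalSpace X] [ChartedSpace E3 X] [IsManifold (𝓡 3) ∞ X] [T2Space X]
      [SecondCountableTopology X] [ConnectedSpace X], ∀ [Kerr.Facts],
      ∀ d ∈ admissibleVacuumData X, ∀ (e : AFEnd X) (M : ℝ), e.IsSoleEnd → 0 < M →
        e.IsStronglyAsymptoticallyFlatDR d M →
        ∃ (sstar : ℝ) (R μ ε : ℝ → ℝ) (O : ℝ → InitialDataSet (𝓡 3) E3),
          ContDiff ℝ ∞ R ∧ (∀ s, sstar < s → max e.R 1 < R s) ∧ Tendsto R atTop atTop ∧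
          ContinuousOn μ (Ioi sstar) ∧ Tendsto (fun s ↦ R s * μ s) atTop (𝓝 M) ∧
          Tendsto (fun s ↦ R s * ε s) atTop (𝓝 0) ∧
          SmoothSectionsOn 𝓘(ℝ, ℝ) O {p : ℝ × E3 | sstar < p.1 ∧ 1 < ‖p.2‖} ∧
          ∀ s, sstar < s →
            VacuumOn {y | 1 < ‖y‖} (O s) ∧
            (∀ y : E3, 1 < ‖y‖ → ‖y‖ < 2 →
              (O s).coordH y = AFEnd.hCoeff e d (R s • y) ∧
                (O s).coordK y = R s • AFEnd.kCoeff e d (R s • y)) ∧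
            (∀ m : ℕ, m ≤ 2 →
              (fun y ↦ ‖iteratedFDeriv ℝ m
                  (fun y ↦ (O s).coordH y - (1 + 2 * μ s / ‖y‖) • (innerSL ℝ : E3 →L[ℝ] E3 →L[ℝ] ℝ)) y‖)
                =o[cobounded E3] fun y ↦ ‖y‖ ^ (-1 - m : ℝ)) ∧
            (∀ m : ℕ, m ≤ 1 →
              (fun y ↦ ‖iteratedFDeriv ℝ m (O s).coordK y‖) =o[cobounded E3] fun y ↦ ‖y‖ ^ (-2 - m : ℝ)) ∧
            (∀ m : ℕ, m ≤ 2 → ∀ y : E3, 1 < ‖y‖ →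
              ‖y‖ ^ (1 + m) *
                ‖iteratedFDeriv ℝ m (fun y ↦ (O s).coordH y - AFEnd.hCoeff e d (R s • y)) y‖ ≤ ε s) ∧
            (∀ m : ℕ, m ≤ 1 → ∀ y : E3, 1 < ‖y‖ →
              ‖y‖ ^ (2 + m) *
                ‖iteratedFDeriv ℝ m (fun y ↦ (O s).coordK y - R s • AFEnd.kCoeff e d (R s • y)) y‖ ≤ ε s) ∧
            ∃ (M' a r₀ : ℝ) (hM' : 0 ≤ M') (ψ : exteriorRegion (32 * R s) → Kerr.region a r₀)
              (ν : NormalField 𝓘(ℝ, E4) ψ),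
              Injective ψ ∧
              (Kerr.smoothMetric M' a r₀).IsSpacelikeImmersion 𝓘(ℝ, E3) ψ ∧
              (Kerr.smoothMetric M' a r₀).IsFutureUnitNormal 𝓘(ℝ, E3)
                ((Kerr.timeOrientation M' a r₀ hM').ofLE le_top) ψ ν ∧
              (∀ (y : exteriorRegion (32 * R s)) (v w : E3),
                ((O s).dilateFamily (R s)).coordH (y : E3) v w =
                  Kerr.bilin M' a (ψ y : E4) (mfderiv 𝓘(ℝ, E3) 𝓘(ℝ, E4) ψ y v)
                    (mfderiv 𝓘(ℝ, E3) 𝓘(ℝ, E4) ψ y w)) ∧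
              (∀ [(Kerr.smoothMetric M' a r₀).HasLeviCivita] (y : exteriorRegion (32 * R s)) (v w : E3),
                ((O s).dilateFamily (R s)).coordK (y : E3) v w =
                  (Kerr.smoothMetric M' a r₀).secondFundamentalForm 𝓘(ℝ, E3) ψ ν y v w)) →
    positive_mass_theorem_spacetime → positive_mass_rigidity_spacetime →
    Summit.FinalStateConjecture.FinalStateConjecture.Theses.ExactKerrEnds.TameEscapeToKerrEnds :=
  fun h hpmt hrig ↦ tameEscapeToKerrEnds_of_matchedKerrGluingCurve_of_pmt_of_rigidity
    (fun X _ _ _ _ _ _ _ d hd e M hsole hM hDR ↦ matchedKerrGluingCurve_of_unitCurve hd hsole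
      (h X d hd e M hsole hM hDR)) hpmt hrig

end Summit.FinalStateConjecture.FinalStateConjecture.Theorems.ExactKerrEnds

end
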